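import Mathlib
import Summits.Parity.Statement
import Summits.Parity.BatemanHorn.Theorems.SoloBlindLinearBHDictionary
import Literature.NumberTheory.Sieve.LinearEquationsInPrimesCountDeduction
import HarnessLib

/-!
# The linear part of Bateman–Horn is a case of the generalised Hardy–Littlewood conjecture
(solo-blind programme, session 12; part 2 of 2 — the `d = 1` dictionary is `SoloBlindLinearBHDictionary`)

The summit `Parity` is the conjunction `BatemanHorn ∧ GeneralizedHardyLittlewood` of

* `Literature.NumberTheory.Sieve.BatemanHornConjecture` — for every Bateman–Horn system
  `f₁, …, f_k ∈ ℤ[X]` (irreducible, positive leading coefficients, pairwise non-associated, no fixed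
  prime divisor) the count `π_f(x) = #{0 ≤ n ≤ x : every fᵢ(n) is a (positive) prime}` satisfies
  `π_f(x) ~ C(f)/(∏ deg fᵢ) · x / (log x)^k`, `C(f) = ∏_p (1 - 1/p)^{-k} (1 - ρ_f(p)/p)`;
* `Literature.NumberTheory.Sieve.GeneralizedHardyLittlewood` — the Green–Tao asymptotic
  `∑_{n ∈ K ∩ [-N,N]^d} ∏ᵢ Λ(ψᵢ(n)) = β_∞ ∏_p β_p + o(N^d)` for every non-degenerate system of
  affine-linear forms in `d ≥ 1` variables, of every complexity.

This file proves, sorry-free, that the **degree-one part of Bateman–Horn is already contained in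
the second conjunct**:

* `batemanHornAsymptotic_of_generalizedHardyLittlewood` — `GeneralizedHardyLittlewood` implies
  `BatemanHornAsymptotic f` for every Bateman–Horn system `f` all of whose members have degree `1`
  (Dickson / Hardy–Littlewood prime `k`-tuples with arbitrary positive dilations `aᵢ n + bᵢ`);
* `batemanHornConjecture_iff_nonlinear` — under `GeneralizedHardyLittlewood`, the Bateman–Horn
  conjecture is equivalent to its restriction to systems containing a member of degree `≥ 2`;
* `parity_iff` — hence `Parity ↔ (Bateman–Horn for systems with a non-linear member) ∧
  GeneralizedHardyLittlewood`: the summit's open content is exactly "non-linear Bateman–Horn"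
  plus "Hardy–Littlewood for linear systems of infinite complexity"; the linear Bateman–Horn
  statements (twin primes, Sophie Germain pairs `n, 2n+1`, prime `k`-tuples, …) are not an
  independent third component.

The proof is a dictionary between the two Literature formalisations at `d = 1`: to
`f = (aᵢ X + bᵢ)ᵢ` we attach the system `linSys f = (n ↦ aᵢ n + bᵢ)ᵢ` of affine-linear forms on
`ℤ¹` and check
1. `linSys f` is non-degenerate (pairwise non-association of irreducible linear polynomials gives
   pairwise non-proportionality of the forms; `isNondegenerateSystem_linSys`);
2. the Green–Tao local factors are the Bateman–Horn local factors:
   `β_p(linSys f) = (1 - 1/p)^{-k} (1 - ρ_f(p)/p)` (`localFactor_linSys`, via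
   `goodCount + ρ_f(p) = p`), so the singular product *is* the Bateman–Horn constant, which the
   tree already knows to be a positive convergent product (`IsBatemanHornSystem.hasBatemanHornConst_holds`);
3. with the convex body `K_N = [0, N] ⊆ [-N, N]`, the Green–Tao prime-point count is `π_f(N)`
   (`primePointCount_linSys`) and the archimedean factor is `N + O_f(1)` (`archFactor_linSys_le`,
   `le_archFactor_linSys`);
4. the unweighted form `GeneralizedHardyLittlewoodCount` of the conjecture (deduced from the
   `Λ`-weighted form in the tree: `generalizedHardyLittlewood_count_of_vonMangoldt_holds`) then
   gives `π_f(N) = (1 + o(1)) C(f) N/(log N)^k`, i.e. `BatemanHornAsymptotic f` (all degrees are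
   `1`, so `∏ deg fᵢ = 1`).  The empty system `k = 0` is handled directly (`π = x + 1 ~ x`, `C = 1`).

All inputs are theorems of the tree (Mathlib + the Literature library); no `sorry`, no new axioms.
-/

noncomputable section

open Filter Finset Polynomial Asymptotics MeasureTheory
open scoped Topology

namespace Summit.Parity.BatemanHorn.Theorems.SoloBlindLinearBH

open Literature.NumberTheory.Sieve
open Summit.Parity.BatemanHorn.Theorems.SoloBlindLinearBHDictionary

/-- The generalised Hardy–Littlewood conjecture of the Literature library (the root-level
`GeneralizedHardyLittlewood` of `Summits.Parity` is an `abbrev` for it). -/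
local notation "GHL" => Literature.NumberTheory.Sieve.GeneralizedHardyLittlewood

/-! ### The real-variable endgame -/

/-- From `|π - aC/ℓ| ≤ ε (aC + N)/ℓ` with `a ∈ [N - B, N]`, `ε = cC/(2(C+1))` and `N ≥ 2B/c`:
`|π - CN/ℓ| ≤ c · CN/ℓ`. -/
theorem endgame {π a C N B ℓ ε c : ℝ} (hℓ : 0 < ℓ) (hC : 0 < C) (hc : 0 < c)
    (h1 : |π - a * C / ℓ| ≤ ε * (a * C + N) / ℓ) (h2 : N - B ≤ a) (h3 : a ≤ N) (hN0 : 0 ≤ N)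
    (hε : ε = c * C / (2 * (C + 1))) (hN : 2 * B / c ≤ N) :
    |π - C * N / ℓ| ≤ c * |C * N / ℓ| := by
  have hε0 : 0 ≤ ε := by rw [hε]; positivity
  have e1 : |a * C / ℓ - C * N / ℓ| ≤ C * B / ℓ := by
    rw [← sub_div, abs_div, abs_of_pos hℓ]
    refine div_le_div_of_nonneg_right ?_ hℓ.le
    rw [show a * C - C * N = -(C * (N - a)) by ring, abs_neg,
      abs_of_nonneg (mul_nonneg hC.le (by linarith))]
    nlinarith
  have e2 : ε * (a * C + N) / ℓ ≤ ε * (N * C + N) / ℓ := by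
    refine div_le_div_of_nonneg_right ?_ hℓ.le
    exact mul_le_mul_of_nonneg_left (by nlinarith) hε0
  have hBN : C * B ≤ c * C * N / 2 := by
    have h' : B ≤ c * N / 2 := by
      rw [div_le_iff₀ hc] at hN
      linarith
    have := mul_le_mul_of_nonneg_left h' hC.le
    linarith
  have hmain : ε * (N * C + N) + C * B ≤ c * (C * N) := by
    have h' : ε * (N * C + N) = c * C * N / 2 := by
      rw [hε]
      field_simp
    rw [h']; linarith
  calc |π - C * N / ℓ| ≤ |π - a * C / ℓ| + |a * C / ℓ - C * N / ℓ| := abs_sub_le _ _ _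
    _ ≤ ε * (N * C + N) / ℓ + C * B / ℓ := add_le_add (h1.trans e2) e1
    _ = (ε * (N * C + N) + C * B) / ℓ := by ring
    _ ≤ c * (C * N) / ℓ := div_le_div_of_nonneg_right hmain hℓ.le
    _ = c * |C * N / ℓ| := by rw [abs_of_nonneg (by positivity), mul_div_assoc]

/-! ### The empty system -/

/-- For the empty system every partial Bateman–Horn product is `1`. -/
theorem batemanHornPartial_fin_zero (f : Fin 0 → ℤ[X]) (x : ℕ) : batemanHornPartial f x = 1 := by
  unfold batemanHornPartial
  refine Finset.prod_eq_one fun p hp => ?_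
  have hpP := (Nat.mem_primesLE.mp hp).2
  have hρ : polyRootCountMod f p = 0 := by
    unfold polyRootCountMod
    rw [Finset.card_eq_zero, Finset.filter_eq_empty_iff]
    intro n _ h
    rw [Fin.prod_univ_zero] at h
    have h1 : (p : ℤ) ∣ ((1 : ℕ) : ℤ) := by simpa using h
    exact hpP.ne_one (Nat.dvd_one.mp (Int.natCast_dvd_natCast.mp h1))
  simp [hρ]

/-- For the empty system the Bateman–Horn count is `x + 1`. -/
theorem polyPrimeCount_fin_zero (f : Fin 0 → ℤ[X]) (x : ℕ) : polyPrimeCount f x = x + 1 := by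
  unfold polyPrimeCount
  rw [Finset.filter_true_of_mem fun n _ => fun i => Fin.elim0 i, card_range]

/-! ### Main theorem -/

/-- **`GHL ⇒ BH` for linear systems.** The generalised Hardy–Littlewood conjecture implies the
Bateman–Horn asymptotic for every Bateman–Horn system of polynomials of degree one. -/
theorem batemanHornAsymptotic_of_generalizedHardyLittlewood (hGHL : GHL) {k : ℕ}
    {f : Fin k → ℤ[X]} (hf : IsBatemanHornSystem f) (hdeg : ∀ i, (f i).natDegree = 1) :
    BatemanHornAsymptotic f := by
  classical
  have hdeg' : ∀ i, (f i).natDegree ≤ 1 := fun i => (hdeg i).le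
  obtain ⟨hSP, hCpos, hC⟩ := singularProduct_linSys hf hdeg'
  refine ⟨batemanHornConst f, hC, ?_⟩
  set C := batemanHornConst f with hCdef
  have hprod : ∏ i, ((f i).natDegree : ℝ) = 1 := by simp [hdeg]
  simp only [hprod, div_one, Fintype.card_fin]
  rcases Nat.eq_zero_or_pos k with hk | hk
  · -- the empty system: `π = x + 1`, `C = 1`
    subst hk
    have hC1 : C = 1 := by
      have h1 : HasBatemanHornConst f 1 :=
        tendsto_const_nhds.congr fun x => (batemanHornPartial_fin_zero f x).symm
      exact tendsto_nhds_unique hC h1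
    simp only [hC1, polyPrimeCount_fin_zero, pow_zero, div_one, one_mul]
    rw [Asymptotics.IsEquivalent, Asymptotics.isLittleO_iff]
    intro c hc
    filter_upwards [eventually_ge_atTop ⌈1 / c⌉₊] with x hx
    have hx' : 1 / c ≤ (x : ℝ) := Nat.ceil_le.mp hx
    rw [div_le_iff₀ hc] at hx'
    simp only [Pi.sub_apply, Nat.cast_add, Nat.cast_one, add_sub_cancel_left, Real.norm_eq_abs,
      abs_one, Nat.abs_cast]
    linarith
  · -- `k ≥ 1`: the unweighted generalised Hardy–Littlewood conjecture at `d = 1`, `t = k`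
    have hcount := generalizedHardyLittlewood_count_of_vonMangoldt_holds hGHL
    have hnd := isNondegenerateSystem_linSys hf hdeg
    set A : ℝ := ∑ i, |((f i).coeff 1 : ℝ)| with hAdef
    set B : ℝ := ∑ i, |((f i).coeff 0 : ℝ)| with hBdef
    set L : ℕ := ⌈A + B⌉₊ with hLdef
    rw [Asymptotics.IsEquivalent, Asymptotics.isLittleO_iff]
    intro c hc
    set ε : ℝ := c * C / (2 * (C + 1)) with hεdef
    have hεpos : 0 < ε := by positivity
    obtain ⟨N₀, hN₀⟩ := hcount 1 k L le_rfl hk ε hεpos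
    filter_upwards [eventually_ge_atTop N₀, eventually_ge_atTop 2,
      eventually_ge_atTop ⌈2 * B / c⌉₊] with N hN hN2 hNB
    have hsize : affLinSize (linSys f) (N : ℝ) ≤ (L : ℝ) :=
      (affLinSize_linSys_le f (by omega)).trans (Nat.le_ceil _)
    have key := hN₀ N hN (linSys f) hnd hsize (boxSet N) (boxSet_convex N) (boxSet_subset N)
    rw [primePointCount_linSys hdeg' N, hSP, pow_one] at key
    have hN1 : (1 : ℝ) < N := by exact_mod_cast (show 1 < N by omega)
    have hℓ : 0 < Real.log N ^ k := pow_pos (Real.log_pos hN1) k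
    simp only [Pi.sub_apply, Real.norm_eq_abs]
    exact endgame hℓ hCpos hc key (le_archFactor_linSys hf hdeg N) (archFactor_linSys_le f N)
      (Nat.cast_nonneg N) hεdef (Nat.ceil_le.mp hNB)

/-! ### Consequences for the summit -/

/-- A Bateman–Horn system has no constant member. -/
theorem one_le_natDegree {k : ℕ} {f : Fin k → ℤ[X]} (hf : IsBatemanHornSystem f) (i : Fin k) :
    1 ≤ (f i).natDegree := hf.natDegree_pos i

/-- Under the generalised Hardy–Littlewood conjecture, the Bateman–Horn conjecture is equivalent to
its restriction to systems with a member of degree `≥ 2`. -/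
theorem batemanHornConjecture_iff_nonlinear (hGHL : GHL) :
    BatemanHornConjecture ↔
      ∀ (k : ℕ) (f : Fin k → ℤ[X]), IsBatemanHornSystem f → (∃ i, 2 ≤ (f i).natDegree) →
        BatemanHornAsymptotic f := by
  refine ⟨fun h k f hf _ => h k f hf, fun h k f hf => ?_⟩
  by_cases hex : ∃ i, 2 ≤ (f i).natDegree
  · exact h k f hf hex
  · push Not at hex
    exact batemanHornAsymptotic_of_generalizedHardyLittlewood hGHL hf
      fun i => le_antisymm (Nat.lt_succ_iff.mp (hex i)) (one_le_natDegree hf i)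

/-- **The summit, re-sorted.** `Parity = BatemanHorn ∧ GeneralizedHardyLittlewood` is equivalent
to "Bateman–Horn for systems with a non-linear member" `∧` "generalised Hardy–Littlewood": the
degree-one Bateman–Horn statements are consequences of the second conjunct. -/
theorem parity_iff :
    _root_.Parity ↔
      (∀ (k : ℕ) (f : Fin k → ℤ[X]), IsBatemanHornSystem f → (∃ i, 2 ≤ (f i).natDegree) →
        BatemanHornAsymptotic f) ∧ GHL := by
  constructor
  · rintro ⟨hBH, hGHL⟩
    exact ⟨(batemanHornConjecture_iff_nonlinear hGHL).mp hBH, hGHL⟩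
  · rintro ⟨hNL, hGHL⟩
    exact ⟨(batemanHornConjecture_iff_nonlinear hGHL).mpr hNL, hGHL⟩

/-- In particular the generalised Hardy–Littlewood conjecture alone implies every linear instance of
Bateman–Horn, e.g. for the Sophie Germain system `(X, 2X + 1)` or any admissible tuple of forms
`aᵢ X + bᵢ`; stated here as the implication between the two conjuncts restricted to degree one. -/
theorem generalizedHardyLittlewood_implies_linear_batemanHorn :
    GHL → ∀ (k : ℕ) (f : Fin k → ℤ[X]), IsBatemanHornSystem f → (∀ i, (f i).natDegree = 1) →
      BatemanHornAsymptotic f :=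
  fun hGHL _ _ hf hdeg => batemanHornAsymptotic_of_generalizedHardyLittlewood hGHL hf hdeg

end Summit.Parity.BatemanHorn.Theorems.SoloBlindLinearBH

end
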